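import Literature.MathematicalPhysics.QuantumFieldTheory.Balaban1983to89.B1Eq324BenfattoSect5Eq534
import HarnessLib

/-!
# `Balaban1983to89.B1Eq324BenfattoSect5StructuralErrors` — [BenfattoEtAl1978] §5 p. 159 «Collecting all the errors made in this process»: the
# STRUCTURAL half of the error ledger of (4.6)/(4.7) — the per-step errors `err₅₁₁`, `err₅₃₄` of the pavement steps summed over the `d + 1`
# displaced steps are `O(|I|)` uniformly in the step, and the constant `s₁` does not depend on `s` beyond `D` — PROVED for the tree's objects

statement-level skeleton of published theorems with citation tags; proofs where landed; nothing here is a claim about the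
Yang–Mills mass gap

WHY THIS MODULE (cell `pub-ymgap`, seat `dag-n08-d` gen 10, INTENT-41; node N08 [Balaban1985UV3]; the [BenfattoEtAl1978] source chain behind the
(α)-row `h324c`).  The (4.7) driver `…Sect5PavementChain.lowerPavementChain_appendixA` (seat `dag-n08-c`) and the assembler's
`…Sect5CollectErrors.ineq47_of_chain` carry the per-step errors of this seat's `…Sect5PavementStep.pavementStep` LITERALLY:
`err₅₁₁(k) = s₁·A·b_k^D·e^{−(ϰ/4)w}·|J_k|` ((5.11)) and `err₅₃₄(k) = s₁·A·b_k^D·(e^{−(ϰ/4)w}|Γ̄₁(B_k)| + e^{−(ϰ/4)v}|B_k|L^d)` ((5.34)), and ask for ONE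
hypothesis `hledger : Σ_{k<d+1}(err₅₁₁ k + err₅₃₄ k + idErr k) + |I|·k₁e^{−k₂b²_{d+1}} ≤ |I|·errTerm S ρ₁ ρ₂ ρ₃ ρ₄ A b t`.  Print (p. 152) wants the
constants `S, ρ₁, …, ρ₄` to depend on `t, D, d, ϰ` only — in particular NOT on `s`, `|I|`, `|J|` or the step.  This file supplies the two
structural facts behind that: (i) `s₁ = s1Const s D d ϰ` is monotone in `s` and CONSTANT for `s ≥ D` (an admissible exponent vector `n₁ … n_p`,
`nᵢ ≥ 1`, `Σnᵢ ≤ D`, forces `p ≤ D`), so `s₁ ≤ s1Const D D d ϰ` for every `s`; (ii) along any chain with `|J_k| ≤ |I|`, `|B_k| ≤ |J_k|` and cut-offs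
`b_k ≤ b̂` the structural errors sum to `≤ n·|I|·3·s₁·A·b̂^D·L^d·e^{−(ϰ/4)v}` (`v ≤ w`, `L ≥ 1`; `|Γ̄₁(B)| ≤ |B|·L^d` is `…Sect5Eq534.card_corridorsBar_le`).
The absorption of the right-hand side into `errTerm` (choice of `ρ₃`, corridor widths `w, v ≍ M·b^{3/2}`, `L = b²`) is the assembler's
(`dag-n08-c` DESIGN-NOTE 2026-08-27) and is NOT done here.

WHAT IS PROVED (standard axioms; no `sorry`; no definition).
* §1 `admissible_eq_empty_of_lt` (`D < p ⇒ admissible p D = ∅`), `s1Const_mono` (monotone in `s`), `s1Const_eq_of_le` (`D ≤ s ⇒ s1Const s D d ϰ =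
  s1Const D D d ϰ`), ★ `s1Const_le_s1Const_self` (`s1Const s D d ϰ ≤ s1Const D D d ϰ` for all `s`).
* §2 `structuralErr_le` (one step: `err₅₁₁ + err₅₃₄ ≤ |I|·3s₁Ab̂^DL^de^{−(ϰ/4)v}`), ★★ `sum_structuralErr_le` (the sum over `n` steps
  `≤ n·|I|·3s₁Ab̂^DL^de^{−(ϰ/4)v}`), in the literal currency of `lowerPavementChain(_appendixA)` / `ineq47_of_chain`.
* §3 `pow_mul_le_of_rec` (`b_{k+1} = γb_k`, `0 ≤ γ ≤ 1` ⇒ `b_k ≤ b_0`), `le_of_rec_div` (the upper chain: `γ·b_{k+1} = b_k`, `0 < γ ≤ 1` ⇒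
  `b_k ≤ b_n` for `k ≤ n`) — the cut-off envelopes `b̂` of the two chains.
HONEST SCOPE.  Bookkeeping inequalities between real numbers already displayed by the landed chain theorems; no measure theory; the
identification losses `idErr`, the Appendix-A term and the absorption into `errTerm` are not here; count-neutral for N08; `BasicLemmaPrinted`
NOT discharged; nothing about d = 4, the continuum, OS axioms, a mass gap or the Clay problem.
-/

noncomputable section

open Finset
open scoped BigOperators

namespace Literature.MathematicalPhysics.QuantumFieldTheory.Balaban1983to89.B1Eq324BenfattoSect5StructuralErrors

open Literature.MathematicalPhysics.QuantumFieldTheory.Balaban1983to89.B1Eq324BenfattoLemma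
open Literature.MathematicalPhysics.QuantumFieldTheory.Balaban1983to89.B1Eq324BenfattoSect5Boxes
open Literature.MathematicalPhysics.QuantumFieldTheory.Balaban1983to89.B1Eq324BenfattoSect5Eq511
open Literature.MathematicalPhysics.QuantumFieldTheory.Balaban1983to89.B1Eq324BenfattoSect5Eq534

variable {d : ℕ}

/-! ## §1  `s₁` does not depend on `s` beyond `D` -/

section S1

/-- **No admissible exponent vector has more than `D` entries**: `nᵢ ≥ 1` for `i < p` and `Σᵢnᵢ ≤ D` force `p ≤ D`.
[cite: BenfattoEtAl1978, (4.5) p.152] -/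
theorem admissible_eq_empty_of_lt {p D : ℕ} (h : D < p) : admissible p D = ∅ := by
  refine Finset.eq_empty_of_forall_notMem fun n hn => ?_
  obtain ⟨hpos, hsum⟩ := mem_admissible.mp hn
  have hp : p ≤ ∑ i, n i := by
    calc p = ∑ _i : Fin p, 1 := by simp
      _ ≤ ∑ i, n i := Finset.sum_le_sum fun i _ => hpos i
  omega

/-- `s₁` is monotone in `s` (its summands are non-negative). [cite: BenfattoEtAl1978, (5.11) p.155] -/
theorem s1Const_mono {κ : ℝ} (hκ : 0 < κ) (D d : ℕ) {s s' : ℕ} (h : s ≤ s') : s1Const s D d κ ≤ s1Const s' D d κ := by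
  unfold s1Const
  refine Finset.sum_le_sum_of_subset_of_nonneg (Finset.Icc_subset_Icc_right h) fun p _ _ => ?_
  refine mul_nonneg (Nat.cast_nonneg _) (pow_nonneg (pow_nonneg (mul_nonneg (div_nonneg (by norm_num) ?_) (Real.exp_pos _).le) d) _)
  rw [sub_nonneg]
  exact Real.exp_le_one_iff.mpr (by
    have : 0 ≤ κ / 4 / (p : ℝ) / Real.sqrt d := by positivity
    linarith)

/-- **`s₁` saturates at `s = D`**: for `s ≥ D` the summands with `p > D` vanish (`admissible p D = ∅`). [cite: BenfattoEtAl1978, (4.5) p.152, (5.11) p.155] -/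
theorem s1Const_eq_of_le (κ : ℝ) {s D : ℕ} (d : ℕ) (h : D ≤ s) : s1Const s D d κ = s1Const D D d κ := by
  unfold s1Const
  symm
  refine Finset.sum_subset (Finset.Icc_subset_Icc_right h) fun p hp hpD => ?_
  have hDp : D < p := by
    rw [Finset.mem_Icc] at hp hpD
    omega
  rw [admissible_eq_empty_of_lt hDp, Finset.card_empty, Nat.cast_zero, zero_mul]

/-- **`s₁ ≤ s₁(D)` for every `s`** — the constant of (5.11)/(5.24)/(5.34) is bounded independently of `s`, as the order of quantifiers of the Lemma
p. 152 (`∃ S … ∀ s`) requires. [cite: BenfattoEtAl1978, Lemma p.152, (5.11) p.155] -/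
theorem s1Const_le_s1Const_self {κ : ℝ} (hκ : 0 < κ) (s D d : ℕ) : s1Const s D d κ ≤ s1Const D D d κ := by
  rcases le_total s D with h | h
  · exact s1Const_mono hκ D d h
  · exact (s1Const_eq_of_le κ d h).le

end S1

/-! ## §2  The structural errors of the pavement steps are `O(|I|)`, uniformly in the step -/

section Structural

variable {s D : ℕ} {κ A : ℝ} {L w v : ℕ}

/-- **One step**: with `|J| ≤ |I|`, `|B| ≤ |J|`, `0 ≤ b ≤ b̂`, `v ≤ w`, `1 ≤ L`:
`err₅₁₁ + err₅₃₄ = s₁Ab^D(e^{−(ϰ/4)w}|J| + e^{−(ϰ/4)w}|Γ̄₁(B)| + e^{−(ϰ/4)v}|B|L^d) ≤ |I|·3·s₁·A·b̂^D·L^d·e^{−(ϰ/4)v}`.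
[cite: BenfattoEtAl1978, (5.11) p.155, (5.34)–(5.35) p.159] -/
theorem structuralErr_le (hκ : 0 < κ) (hA0 : 0 ≤ A) (hv : v ≤ w) (hL : 1 ≤ L)
    {J B : Finset (B1Eq324BenfattoLemma.Site d)} {nI : ℕ} (hJ : J.card ≤ nI) (hB : B.card ≤ J.card)
    {b bhat : ℝ} (hb0 : 0 ≤ b) (hb : b ≤ bhat) :
    s1Const s D d κ * A * b ^ D * Real.exp (-(κ / 4 * w)) * J.card
        + s1Const s D d κ * A * b ^ D *
          (Real.exp (-(κ / 4 * w)) * (corridorsBar L w v B).card + Real.exp (-(κ / 4 * v)) * (B.card * (L : ℝ) ^ d))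
      ≤ nI * (3 * (s1Const s D d κ * A * bhat ^ D * (L : ℝ) ^ d * Real.exp (-(κ / 4 * v)))) := by
  have hs1 : 0 ≤ s1Const s D d κ := s1Const_nonneg hκ s D d
  have hLd : (1 : ℝ) ≤ (L : ℝ) ^ d := one_le_pow₀ (by exact_mod_cast hL)
  have hLd0 : (0 : ℝ) ≤ (L : ℝ) ^ d := zero_le_one.trans hLd
  have hwv : Real.exp (-(κ / 4 * w)) ≤ Real.exp (-(κ / 4 * v)) := by
    rw [Real.exp_le_exp]
    have : (v : ℝ) ≤ w := by exact_mod_cast hv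
    nlinarith
  have hev0 : 0 ≤ Real.exp (-(κ / 4 * v)) := (Real.exp_pos _).le
  have hew0 : 0 ≤ Real.exp (-(κ / 4 * w)) := (Real.exp_pos _).le
  have hbD : b ^ D ≤ bhat ^ D := pow_le_pow_left₀ hb0 hb D
  have hbD0 : 0 ≤ b ^ D := pow_nonneg hb0 D
  have hJI : (J.card : ℝ) ≤ nI := by exact_mod_cast hJ
  have hBI : (B.card : ℝ) ≤ nI := by exact_mod_cast hB.trans hJ
  have hΓ : ((corridorsBar L w v B).card : ℝ) ≤ nI * (L : ℝ) ^ d := by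
    have h := card_corridorsBar_le L w v B (d := d)
    have h' : ((corridorsBar L w v B).card : ℝ) ≤ B.card * (L : ℝ) ^ d := by exact_mod_cast h
    exact h'.trans (mul_le_mul_of_nonneg_right hBI hLd0)
  -- common factor `c = s₁ A b^D ≤ ĉ = s₁ A b̂^D`
  set c : ℝ := s1Const s D d κ * A * b ^ D with hc
  set chat : ℝ := s1Const s D d κ * A * bhat ^ D with hchat
  have hc0 : 0 ≤ c := mul_nonneg (mul_nonneg hs1 hA0) hbD0
  have hcc : c ≤ chat := mul_le_mul_of_nonneg_left hbD (mul_nonneg hs1 hA0)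
  have hchat0 : 0 ≤ chat := hc0.trans hcc
  -- three pieces, each `≤ nI · ĉ · L^d · e^{−(ϰ/4)v}`
  have h1 : c * Real.exp (-(κ / 4 * w)) * J.card ≤ nI * (chat * (L : ℝ) ^ d * Real.exp (-(κ / 4 * v))) := by
    calc c * Real.exp (-(κ / 4 * w)) * J.card ≤ chat * Real.exp (-(κ / 4 * v)) * nI := by
          gcongr
      _ ≤ chat * (L : ℝ) ^ d * Real.exp (-(κ / 4 * v)) * nI := by
          have hce : 0 ≤ chat * Real.exp (-(κ / 4 * v)) := mul_nonneg hchat0 hev0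
          have : chat * Real.exp (-(κ / 4 * v)) ≤ chat * (L : ℝ) ^ d * Real.exp (-(κ / 4 * v)) := by
            nlinarith [mul_nonneg hce (sub_nonneg.mpr hLd)]
          exact mul_le_mul_of_nonneg_right this (Nat.cast_nonneg _)
      _ = nI * (chat * (L : ℝ) ^ d * Real.exp (-(κ / 4 * v))) := by ring
  have h2 : c * (Real.exp (-(κ / 4 * w)) * (corridorsBar L w v B).card) ≤ nI * (chat * (L : ℝ) ^ d * Real.exp (-(κ / 4 * v))) := by
    calc c * (Real.exp (-(κ / 4 * w)) * (corridorsBar L w v B).card) ≤ chat * (Real.exp (-(κ / 4 * v)) * (nI * (L : ℝ) ^ d)) := by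
          gcongr
      _ = nI * (chat * (L : ℝ) ^ d * Real.exp (-(κ / 4 * v))) := by ring
  have h3 : c * (Real.exp (-(κ / 4 * v)) * (B.card * (L : ℝ) ^ d)) ≤ nI * (chat * (L : ℝ) ^ d * Real.exp (-(κ / 4 * v))) := by
    calc c * (Real.exp (-(κ / 4 * v)) * (B.card * (L : ℝ) ^ d)) ≤ chat * (Real.exp (-(κ / 4 * v)) * (nI * (L : ℝ) ^ d)) := by
          gcongr
      _ = nI * (chat * (L : ℝ) ^ d * Real.exp (-(κ / 4 * v))) := by ring
  have hsplit : c * Real.exp (-(κ / 4 * w)) * J.card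
      + c * (Real.exp (-(κ / 4 * w)) * (corridorsBar L w v B).card + Real.exp (-(κ / 4 * v)) * (B.card * (L : ℝ) ^ d))
      = c * Real.exp (-(κ / 4 * w)) * J.card + c * (Real.exp (-(κ / 4 * w)) * (corridorsBar L w v B).card)
        + c * (Real.exp (-(κ / 4 * v)) * (B.card * (L : ℝ) ^ d)) := by ring
  rw [hsplit]
  calc _ ≤ nI * (chat * (L : ℝ) ^ d * Real.exp (-(κ / 4 * v))) + nI * (chat * (L : ℝ) ^ d * Real.exp (-(κ / 4 * v)))
        + nI * (chat * (L : ℝ) ^ d * Real.exp (-(κ / 4 * v))) := add_le_add (add_le_add h1 h2) h3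
    _ = nI * (3 * (chat * (L : ℝ) ^ d * Real.exp (-(κ / 4 * v)))) := by ring
    _ = nI * (3 * (s1Const s D d κ * A * bhat ^ D * (L : ℝ) ^ d * Real.exp (-(κ / 4 * v)))) := by rw [hchat]

/-- **THE STRUCTURAL ERROR LEDGER OVER `n` STEPS** — in the literal currency of `…Sect5PavementChain.lowerPavementChain(_appendixA)` /
`…Sect5CollectErrors.ineq47_of_chain` (`hledger`): along step data with `|J_k| ≤ |I|`, `|B_k| ≤ |J_k|` and cut-offs `0 ≤ b_k ≤ b̂` (`k < n`),
`Σ_{k<n}(err₅₁₁(k) + err₅₃₄(k)) ≤ n·|I|·3·s₁·A·b̂^D·L^d·e^{−(ϰ/4)v}` — «Collecting all the errors made in this process», structural part; with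
`L = b²`, `v ≍ M b^{3/2}` the right-hand side is `|I|·O(A b^{D+2d} e^{−(ϰM/4)b^{3/2}})`, to be absorbed into `|I|·errTerm` by the assembler.
[cite: BenfattoEtAl1978, §5 p.159, (4.6)–(4.7) p.152] -/
theorem sum_structuralErr_le (hκ : 0 < κ) (hA0 : 0 ≤ A) (hv : v ≤ w) (hL : 1 ≤ L) {n nI : ℕ}
    {Js Bs : ℕ → Finset (B1Eq324BenfattoLemma.Site d)} {bs : ℕ → ℝ} {bhat : ℝ}
    (hJ : ∀ k < n, (Js k).card ≤ nI) (hB : ∀ k < n, (Bs k).card ≤ (Js k).card) (hb0 : ∀ k < n, 0 ≤ bs k) (hb : ∀ k < n, bs k ≤ bhat) :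
    ∑ k ∈ Finset.range n,
        (s1Const s D d κ * A * bs k ^ D * Real.exp (-(κ / 4 * w)) * (Js k).card
          + s1Const s D d κ * A * bs k ^ D *
            (Real.exp (-(κ / 4 * w)) * (corridorsBar L w v (Bs k)).card + Real.exp (-(κ / 4 * v)) * ((Bs k).card * (L : ℝ) ^ d)))
      ≤ n * (nI * (3 * (s1Const s D d κ * A * bhat ^ D * (L : ℝ) ^ d * Real.exp (-(κ / 4 * v))))) := by
  calc _ ≤ ∑ _k ∈ Finset.range n, (nI : ℝ) * (3 * (s1Const s D d κ * A * bhat ^ D * (L : ℝ) ^ d * Real.exp (-(κ / 4 * v)))) :=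
        Finset.sum_le_sum fun k hk => by
          have hk' := Finset.mem_range.mp hk
          exact structuralErr_le hκ hA0 hv hL (hJ k hk') (hB k hk') (hb0 k hk') (hb k hk')
    _ = _ := by rw [Finset.sum_const, Finset.card_range, nsmul_eq_mul]

/-- The box families of the chain are images of the (translated) supports: `|B_k| ≤ |J_k|` when `B_k = ((J_k + τ_k).image boxIndex)`.
[cite: BenfattoEtAl1978, §5 p.154] -/
theorem card_image_boxIndex_image_le (L : ℕ) (J : Finset (B1Eq324BenfattoLemma.Site d)) (τ : B1Eq324BenfattoLemma.Site d) :
    ((J.image fun x => x + τ).image (boxIndex L)).card ≤ J.card :=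
  Finset.card_image_le.trans Finset.card_image_le

end Structural

/-! ## §3  The cut-off envelopes of the two chains -/

section Envelopes

/-- **Lower chain**: `b_{k+1} = γ·b_k` with `0 ≤ γ ≤ 1` and `0 ≤ b_0` gives `0 ≤ b_k ≤ b_0` for `k ≤ n`. [cite: BenfattoEtAl1978, §5 p.154 «b, γb, γ²b, …»] -/
theorem rec_mul_le {bs : ℕ → ℝ} {γ : ℝ} {n : ℕ} (hγ0 : 0 ≤ γ) (hγ : γ ≤ 1) (hb0 : 0 ≤ bs 0)
    (hrec : ∀ k < n, bs (k + 1) = γ * bs k) : ∀ k ≤ n, 0 ≤ bs k ∧ bs k ≤ bs 0 := by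
  intro k
  induction k with
  | zero => exact fun _ => ⟨hb0, le_rfl⟩
  | succ k ih =>
    intro hk
    obtain ⟨h0, h1⟩ := ih (Nat.le_of_succ_le hk)
    rw [hrec k (Nat.lt_of_succ_le hk)]
    exact ⟨mul_nonneg hγ0 h0, (mul_le_of_le_one_left h0 hγ).trans h1⟩

/-- **Upper chain**: `γ·b_{k+1} = b_k` with `0 < γ ≤ 1` and `0 ≤ b_0` gives `0 ≤ b_k ≤ b_n` for `k ≤ n` (the cut-offs grow, «b replaced by γ⁻¹b»).
[cite: BenfattoEtAl1978, §5 (5.36) p.159] -/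
theorem rec_div_le {bs : ℕ → ℝ} {γ : ℝ} {n : ℕ} (hγ0 : 0 < γ) (hγ : γ ≤ 1) (hb0 : 0 ≤ bs 0)
    (hrec : ∀ k < n, γ * bs (k + 1) = bs k) : ∀ k ≤ n, 0 ≤ bs k ∧ bs k ≤ bs n := by
  -- monotonicity step by step
  have hmono : ∀ k < n, 0 ≤ bs k → 0 ≤ bs (k + 1) ∧ bs k ≤ bs (k + 1) := by
    intro k hk h0
    have h := hrec k hk
    have h1 : bs (k + 1) = bs k / γ := by
      field_simp
      linarith
    refine ⟨?_, ?_⟩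
    · rw [h1]; exact div_nonneg h0 hγ0.le
    · rw [h1]; exact le_div_self h0 hγ0 hγ
  have hnonneg : ∀ k ≤ n, 0 ≤ bs k := by
    intro k
    induction k with
    | zero => exact fun _ => hb0
    | succ k ih => exact fun hk => (hmono k (Nat.lt_of_succ_le hk) (ih (Nat.le_of_succ_le hk))).1
  -- `bs k ≤ bs n` by downward induction on the gap
  have hle : ∀ j k, k + j = n → bs k ≤ bs n := by
    intro j
    induction j with
    | zero => intro k hk; rw [Nat.add_zero] at hk; rw [hk]
    | succ j ih =>
      intro k hk
      have hk' : k < n := by omega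
      exact (hmono k hk' (hnonneg k hk'.le)).2.trans (ih (k + 1) (by omega))
  exact fun k hk => ⟨hnonneg k hk, hle (n - k) k (by omega)⟩

end Envelopes

end Literature.MathematicalPhysics.QuantumFieldTheory.Balaban1983to89.B1Eq324BenfattoSect5StructuralErrors

end
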